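import Literature.AnabelianGeometry.AbsoluteAnabelian.MLFGaloisTLGUnits

/-!
# [AbsTopIII] Lemma 3.4 for automorphisms of the MLF-Galois `TLG`-pair `(Π_k ↷ k̄^×)` — unconditional

Proof-only companion (no definitions) of `MLFGaloisModel.lean` / `MLFGaloisTLGUnits.lean` (seat
abc-iut-L4-t2; S. Mochizuki, *Topics in absolute anabelian geometry III*, §3, Lemma 3.4 p. 74, bib key
`MochizukiAbsTopIII2015`): "(Topological Distinguishability of Additive and Multiplicative Structures)
… let `α : k̄^× ⥲ k̄^×` be an automorphism of the topological group `k̄^×` … Then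
`α^pf((𝒪_k̄^⊳)^pf) ⊄ (𝒪_k̄^×)^pf`."  The printed proof: "`𝒪_k̄^×` is easily verified to be the maximal
compact subgroup of `k̄^×`", so `α(𝒪_k̄^×) = 𝒪_k̄^×`, and then `α(ϖ)` has no positive power in `𝒪_k̄^×`.

The gen-0 typing (`pow_not_mem_unitSubmonoid_of_preserves`, `MLFGaloisModel.lean`) PROVED the second
step for an abstract multiplicative automorphism `α` ASSUMED to preserve `𝒪_k̄^×`, the topological first
step being untyped (the tree's arithmetic data carry no ind-topology, Rmk 3.1.1).  Where Lemma 3.4 is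
USED (Cor 3.6 (iv) p. 81, Cor 3.7 (iv): the log-Frobenius INcompatibility), `α` arises from an
isomorphism of MLF-Galois pairs, i.e. is GALOIS-EQUIVARIANT; and a Galois-equivariant automorphism
preserves `𝒪_k̄^×` by the intrinsic (Galois-theoretic) form of Rmk 3.1.1 — it preserves intrinsic units
(`GaloisMonoidPair.isIntrinsicUnit_iff_of_iso`), which are `𝒪_k̄^×` (`isIntrinsicUnit_tlgPair_iff`).
Hence:

* `ModelMLFGaloisData.tlgPairIso_mem_unitSubmonoid_iff` — every automorphism of the PAIR `(Π_k ↷ k̄^×)`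
  maps `𝒪_k̄^×` onto itself;
* **`ModelMLFGaloisData.lemma34_of_tlgPairIso`** — Lemma 3.4 UNCONDITIONALLY for automorphisms `α` of
  the MLF-Galois `TLG`-pair `(Π_k ↷ k̄^×)`: some `x ∈ 𝒪_k̄^⊳` has no positive power of `α(x)` in `𝒪_k̄^×`
  (equivalently `α^pf((𝒪^⊳)^pf) ⊄ (𝒪^×)^pf`).

HONEST FRAMING: the hypothesis "automorphism of the topological group `k̄^×`" of print is REPLACED by
"automorphism of the pair `(Π_k ↷ k̄^×)`" (Galois-equivariance instead of continuity) — the form in which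
Cor 3.6/3.7 invoke the lemma; the topological clause itself stays untyped.  OUR kernel check of a
classical step; nothing here bears on [IUTchIII] Cor. 3.12.
-/

noncomputable section

universe u

namespace Literature.AnabelianGeometry.AbsoluteAnabelian

open _root_.ValuativeRel
open scoped nonZeroDivisors

namespace ModelMLFGaloisData

variable (C : MLFClosure.{u}) (D : ModelMLFGaloisData C.k C.K)

/-- **An automorphism of the pair `(Π_k ↷ k̄^×)` preserves `𝒪_k̄^×`**: `x ∈ 𝒪_k̄^× ↔ α(x) ∈ 𝒪_k̄^×`
(intrinsic units are transported by isomorphisms of pairs and are `𝒪_k̄^×` on the model).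
[cite: MochizukiAbsTopIII2015, Lemma 3.4 p.74] -/
theorem tlgPairIso_mem_unitSubmonoid_iff (α : GaloisMonoidPair.Iso D.tlgPair D.tlgPair)
    (x : D.tlgPair.M) :
    (x : C.K) ∈ unitSubmonoid C.k C.K ↔ ((α.isoM x : D.tlgPair.M) : C.K) ∈ unitSubmonoid C.k C.K := by
  rw [← D.isIntrinsicUnit_tlgPair_iff C x, ← D.isIntrinsicUnit_tlgPair_iff C (α.isoM x)]
  exact GaloisMonoidPair.isIntrinsicUnit_iff_of_iso α x

/-- **Lemma 3.4 for automorphisms of the MLF-Galois `TLG`-pair `(Π_k ↷ k̄^×)`** (unconditional): for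
every automorphism `α` of the pair there is a non-zero integer `x ∈ 𝒪_k̄^⊳` no positive power of whose
image `α(x)` lies in `𝒪_k̄^×` — i.e. `α^pf((𝒪_k̄^⊳)^pf) ⊄ (𝒪_k̄^×)^pf` ("Topological Distinguishability of
Additive and Multiplicative Structures", with Galois-equivariance in place of continuity).
[cite: MochizukiAbsTopIII2015, Lemma 3.4 p.74] -/
theorem lemma34_of_tlgPairIso (α : GaloisMonoidPair.Iso D.tlgPair D.tlgPair) :
    ∃ x : D.tlgPair.M, (x : C.K) ∈ nonzeroIntegers C.k C.K ∧
      ∀ n : ℕ, 0 < n → ((α.isoM x : D.tlgPair.M) : C.K) ^ n ∉ unitSubmonoid C.k C.K :=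
  pow_not_mem_unitSubmonoid_of_preserves C α.isoM (fun x => D.tlgPairIso_mem_unitSubmonoid_iff C α x)

end ModelMLFGaloisData

end Literature.AnabelianGeometry.AbsoluteAnabelian

end
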